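import Literature.AnabelianGeometry.SemiGraphs.PSCSmoothProperOrigin
import Literature.GroupTheory.CombinatorialGroupTheory.PuncturedSurfaceGroupFree
import Literature.IUT.HodgeTheaters.DiscreteProfiniteCompletionsAssembly
import Mathlib.GroupTheory.SpecificGroups.Dihedral
import HarnessLib

/-!
# [IUTchI] Rmk. 1.2.3 (iv), verticial half, AS TYPED: `UnrVerticialSplitInjection` fails at one vertex (abc-iut FACT-LIST row F-1938)

Mochizuki, *Inter-universal Teichmüller theory I* [IUTchI] Rmk. 1.2.3 (iv) p. 42 ("the inclusions
`M^unr_G[v] ⊆ M^unr_G` determine a split injection `⊕_v M^unr_G[v] ↪ M^unr_G`"), typed by abc-iut-L3-t4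
(gen 0) as `PSCDatum.UnrVerticialSplitInjection` (`PSCRamification.lean`) and quantified over the origin
parameter in `UnrVerticialCharacterizationHolds Ω` (row F-1938).  [cite: Mochizuki2012, IUTchI Rmk 1.2.3(iv) p.42]

FINDING (abc-iut F-L3t4g5-1, this lineage on its own file).  The typed independence clause is
`unrVertAbOf v ⊓ (⨆ w : {w // w ≠ v}, unrVertAbOf w).topologicalClosure = unrAbKer`.  At a datum with ONE
vertex (`i(G) = 1`: every smooth curve, every irreducible pointed stable curve) the `⨆` runs over an
EMPTY type and is `⊥`, so the clause forces `unrAbKer ≤ closure {1}`, i.e. `[Π, Π] ≤ closure {1}`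
(`commutator_le_closure_bot_of_unrVerticialSplitInjection`): over a T₁ group, `Π` ABELIAN
(`mul_comm_of_unrVerticialSplitInjection`).  For `≥ 2` vertices the clause is the intended one
(`unrVertAbOf w ⊇ unrAbKer`).  Consequences recorded here (PROOF-ONLY file, no `def`/`structure`/`instance`):

* `not_unrVerticialSplitInjection_of_oneVertex`, `not_unrVerticialCharacterizationHolds_of_oneVertex`:
  F-1938 fails at EVERY origin containing a one-vertex sturdy datum over a nonabelian T₁ group;
* `not_unrVerticialCharacterizationHolds_of_genus2OnePoint`: in particular at every origin containing
  the GENUINE datum of a smooth genus-2 curve with one marked point in characteristic 0 — carrier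
  `Γ̂_{2,1}` (profinite completion of the free group `Γ_{2,1} = π₁`), `Σ` = all primes, one vertex of
  genus 2, one cusp with `Π_c = closure of the image of ⟨c₁⟩` — nonabelian by the tree's
  `PuncturedSurfaceGroup.exists_mul_ne_mul` and `FreeOrSurface.toCompletion_injective`.  The intended
  geometric origin of Def. 1.1 (i) contains this datum, so F-1938 AS TYPED is refuted there;
* `not_forall_unrVerticialCharacterizationHolds` (the universal closure, plan R1 (ii));
* `exists_smoothProperOrigin_holds`: the origin `Ω_sp` of all smooth-proper-shaped data (one vertex, no
  edges, `Π_v = Π`; inhabited by the genuine sturdy datum `Ŝ₂` of a smooth proper genus-2 curve,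
  `Σ` = all primes) satisfies the TEN companion rows F-0438/0440/0443/0444/0458/0459/0461/0466/1931/1937
  (`PSCSmoothProperOrigin.lean`) and VIOLATES F-1938 (witness: the smooth-proper-shaped junk datum over
  the dihedral group of order 8, `Σ = {2}`).

The corrected successor predicate (clause `unrVertAbOf v ⊓ (unrAbKer ⊔ ⨆ w ≠ v, unrVertAbOf w)⁻ = unrAbKer`)
is filed separately; consumers of F-1938 (`PSCThm16iiiAssemblyProofs`, `CoveringsErrataNecessityProofs`,
`PSCVertexSetCharacterizationHoldsProofs`, `PSCVertexQuotient*Proofs`) keep their theorems, whose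
hypothesis is however unsatisfiable at the geometric origin as typed.  FACT policy: F-1938 is an
assumption label; nothing is asserted about multi-vertex data; no side is taken on [IUTchIII] Cor. 3.12.
-/

noncomputable section

namespace Literature.AnabelianGeometry.SemiGraphs

namespace PSCDatum

open scoped Pointwise
open Literature.GroupTheory.CombinatorialGroupTheory
open Literature.IUT.HodgeTheaters (profiniteCompletion toCompletion)

universe u

variable {P : Type u} [Group P] [TopologicalSpace P] [IsTopologicalGroup P]

/-! ### The typed split injection at one vertex forces commutativity -/

section OneVertex

variable (G : PSCDatum P)

/-- At a one-vertex sturdy datum the typed independence clause of `UnrVerticialSplitInjection` reads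
`unrVertAbOf v ⊓ closure {1} = unrAbKer`, whence `[Π, Π] ≤ unrAbKer ≤ closure {1}`.
[cite: Mochizuki2012, IUTchI Rmk 1.2.3(iv) p.42] -/
theorem commutator_le_closure_bot_of_unrVerticialSplitInjection (v₀ : G.graph.V)
    (hv : ∀ w, w = v₀) (hst : G.IsSturdy) (h : G.UnrVerticialSplitInjection) :
    ⁅(⊤ : Subgroup P), (⊤ : Subgroup P)⁆ ≤ (⊥ : Subgroup P).topologicalClosure := by
  obtain ⟨hind, -⟩ := h hst
  have h1 := hind v₀
  haveI : IsEmpty {w : G.graph.V // w ≠ v₀} := ⟨fun w => w.2 (hv w.1)⟩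
  rw [iSup_of_empty] at h1
  calc ⁅(⊤ : Subgroup P), (⊤ : Subgroup P)⁆ ≤ G.unrAbKer :=
        le_trans le_sup_left (Subgroup.le_topologicalClosure _)
    _ = G.unrVertAbOf v₀ ⊓ (⊥ : Subgroup P).topologicalClosure := h1.symm
    _ ≤ _ := inf_le_right

/-- Hence, over a T₁ group, a one-vertex sturdy datum satisfying the typed split injection has ABELIAN
`Π`. [cite: Mochizuki2012, IUTchI Rmk 1.2.3(iv) p.42] -/
theorem mul_comm_of_unrVerticialSplitInjection [T1Space P] (v₀ : G.graph.V) (hv : ∀ w, w = v₀)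
    (hst : G.IsSturdy) (h : G.UnrVerticialSplitInjection) (a b : P) : a * b = b * a := by
  have hbot : (⊥ : Subgroup P).topologicalClosure = ⊥ :=
    le_antisymm (Subgroup.topologicalClosure_minimal _ le_rfl (by
      rw [Subgroup.coe_bot]; exact isClosed_singleton)) bot_le
  have hle := G.commutator_le_closure_bot_of_unrVerticialSplitInjection v₀ hv hst h
  rw [hbot] at hle
  have hmem : a * b * a⁻¹ * b⁻¹ ∈ ⁅(⊤ : Subgroup P), (⊤ : Subgroup P)⁆ :=
    Subgroup.commutator_mem_commutator (Subgroup.mem_top a) (Subgroup.mem_top b)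
  have h1 : a * b * a⁻¹ * b⁻¹ = 1 := Subgroup.mem_bot.mp (hle hmem)
  exact commutatorElement_eq_one_iff_mul_comm.mp h1

/-- **The typed `UnrVerticialSplitInjection` FAILS at every one-vertex sturdy datum over a nonabelian
T₁ group.** [cite: Mochizuki2012, IUTchI Rmk 1.2.3(iv) p.42] -/
theorem not_unrVerticialSplitInjection_of_oneVertex [T1Space P] (v₀ : G.graph.V) (hv : ∀ w, w = v₀)
    (hst : G.IsSturdy) (hab : ∃ a b : P, a * b ≠ b * a) : ¬ G.UnrVerticialSplitInjection := fun h => by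
  obtain ⟨a, b, hab⟩ := hab
  exact hab (G.mul_comm_of_unrVerticialSplitInjection v₀ hv hst h a b)

end OneVertex

/-- **Row F-1938 fails at every origin containing a one-vertex sturdy datum over a nonabelian T₁
group.** [cite: Mochizuki2012, IUTchI Rmk 1.2.3(iv) p.42] -/
theorem not_unrVerticialCharacterizationHolds_of_oneVertex (Ω : PSCOrigin.{u}) {Q : Type u} [Group Q]
    [TopologicalSpace Q] [IsTopologicalGroup Q] [T1Space Q] (G : PSCDatum Q) (hG : Ω.IsOfPSCType G)
    (v₀ : G.graph.V) (hv : ∀ w, w = v₀) (hst : G.IsSturdy) (hab : ∃ a b : Q, a * b ≠ b * a) :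
    ¬ UnrVerticialCharacterizationHolds Ω := fun h =>
  G.not_unrVerticialSplitInjection_of_oneVertex v₀ hv hst hab (h G hG).1

/-! ### The genuine one-vertex sturdy datum: a smooth genus-2 curve with one marked point -/

/-- **F-1938 fails at the datum of a smooth genus-2 curve with ONE marked point** (characteristic 0,
`Σ` = all primes): `Π_G = Γ̂_{2,1}` (profinite completion of `Γ_{2,1} = ⟨a₁,b₁,a₂,b₂,c₁ ∣ [a₁,b₁][a₂,b₂]c₁⟩`,
a free group of rank 4), one vertex of genus 2 with `Π_v = Π_G`, no node, one cusp with
`Π_c = closure of η(⟨c₁⟩)`.  The datum EXISTS with these fields (stated as `∃`, this file being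
proof-only), is sturdy, violates the typed split injection, and kills `UnrVerticialCharacterizationHolds`
at every origin declaring it "of PSC-type" — as the intended geometric origin of Def. 1.1 (i) does.
(`Γ̂_{2,1}` is nonabelian: `Γ_{2,1}` is a nonabelian free group and `η : Γ_{2,1} → Γ̂_{2,1}` is injective.)
[cite: Mochizuki2012, IUTchI Rmk 1.2.3(iv) p.42] -/
theorem not_unrVerticialCharacterizationHolds_of_genus2OnePoint :
    ∃ G : PSCDatum (profiniteCompletion (PuncturedSurfaceGroup 2 1)),
      G.Sigma = {p | p.Prime} ∧ G.graph.i = 1 ∧ G.graph.n = 0 ∧ G.graph.r = 1 ∧ G.IsSturdy ∧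
      (∀ v, G.vertGp v = ⊤ ∧ G.genus v = 2) ∧
      (∀ c, G.cuspGp c = ((PuncturedSurfaceGroup.cuspInertia (g := 2) (r := 1) 0).map
        (toCompletion (PuncturedSurfaceGroup 2 1))).topologicalClosure) ∧
      ¬ G.UnrVerticialSplitInjection ∧
      ∀ Ω : PSCOrigin.{0}, Ω.IsOfPSCType G → ¬ UnrVerticialCharacterizationHolds Ω := by
  let Pc : Subgroup (profiniteCompletion (PuncturedSurfaceGroup 2 1)) :=
    ((PuncturedSurfaceGroup.cuspInertia (g := 2) (r := 1) 0).map
      (toCompletion (PuncturedSurfaceGroup 2 1))).topologicalClosure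
  let G : PSCDatum (profiniteCompletion (PuncturedSurfaceGroup 2 1)) :=
    { Sigma := {p | p.Prime}
      sigma_prime := fun _ hp => hp
      sigma_nonempty := ⟨2, Nat.prime_two⟩
      graph := { V := Unit, N := Empty, C := Unit, nodeEnds := Empty.elim, cuspEnd := fun _ => () }
      vertGp := fun _ => ⊤
      nodeGp := Empty.elim
      cuspGp := fun _ => Pc
      genus := fun _ => 2
      isClosed_vertGp := fun _ => by rw [Subgroup.coe_top]; exact isClosed_univ
      isClosed_nodeGp := fun e => e.elim
      isClosed_cuspGp := fun _ => Subgroup.isClosed_topologicalClosure _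
      nodeGp_le := fun e => e.elim
      cuspGp_le := fun _ => ⟨1, le_top⟩
      proSigma := ⟨fun _ _ _ hp _ => hp⟩ }
  -- `Γ̂_{2,1}` is nonabelian
  have hab : ∃ a b : profiniteCompletion (PuncturedSurfaceGroup 2 1), a * b ≠ b * a := by
    obtain ⟨x, y, hxy⟩ := PuncturedSurfaceGroup.exists_mul_ne_mul (g := 2) (r := 0)
      (by unfold PuncturedSurfaceGroup.IsHyperbolicType; norm_num)
    obtain ⟨e⟩ := PuncturedSurfaceGroup.nonempty_mulEquiv_freeGroup 2 0
    haveI : IsFreeGroup (PuncturedSurfaceGroup 2 1) := IsFreeGroup.ofMulEquiv e.symm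
    have hinj := Literature.IUT.HodgeTheaters.FreeOrSurface.toCompletion_injective
      (PuncturedSurfaceGroup 2 1)
    refine ⟨toCompletion _ x, toCompletion _ y, fun h => hxy (hinj ?_)⟩
    rw [map_mul, map_mul, h]
  have hsturdy : G.IsSturdy := fun _ => le_rfl
  have hnot : ¬ G.UnrVerticialSplitInjection :=
    G.not_unrVerticialSplitInjection_of_oneVertex () (fun _ => rfl) hsturdy hab
  exact ⟨G, rfl, rfl, rfl, rfl, hsturdy, fun _ => ⟨rfl, rfl⟩, fun _ => rfl, hnot,
    fun Ω hG h => hnot (h G hG).1⟩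

/-! ### Origins of smooth-proper-shaped data: ten rows hold, F-1938 fails -/

/-- **F-1938 fails at every origin containing all STURDY data of smooth-proper shape** (one vertex,
no edges, `Π_v = Π`) — witness: the junk datum of that shape over the dihedral group of order 8
(discrete, `Σ = {2}`, genus 2), nonabelian.  [cite: Mochizuki2012, IUTchI Rmk 1.2.3(iv) p.42] -/
theorem not_unrVerticialCharacterizationHolds_of_smoothProper_le (Ω : PSCOrigin.{0})
    (hΩ : ∀ ⦃Q : Type⦄ [Group Q] [TopologicalSpace Q] [IsTopologicalGroup Q] (G : PSCDatum Q),
      IsEmpty G.graph.N → IsEmpty G.graph.C → (∀ v, G.vertGp v = ⊤) → (∃ v₀ : G.graph.V, ∀ w, w = v₀) →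
      G.IsSturdy → Ω.IsOfPSCType G) :
    ¬ UnrVerticialCharacterizationHolds Ω := by
  letI : TopologicalSpace (DihedralGroup 4) := ⊥
  haveI : DiscreteTopology (DihedralGroup 4) := ⟨rfl⟩
  haveI : T1Space (DihedralGroup 4) := ⟨fun _ => isClosed_discrete _⟩
  let G : PSCDatum (DihedralGroup 4) :=
    { Sigma := {2}
      sigma_prime := by simp [Nat.prime_two]
      sigma_nonempty := ⟨2, rfl⟩
      graph := { V := Unit, N := Empty, C := Empty, nodeEnds := Empty.elim, cuspEnd := Empty.elim }
      vertGp := fun _ => ⊤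
      nodeGp := Empty.elim
      cuspGp := Empty.elim
      genus := fun _ => 2
      isClosed_vertGp := fun _ => isClosed_discrete _
      isClosed_nodeGp := fun e => e.elim
      isClosed_cuspGp := fun c => c.elim
      nodeGp_le := fun e => e.elim
      cuspGp_le := fun c => c.elim
      proSigma := ⟨fun U _ p hp hdvd => by
        have h8 : Nat.card (DihedralGroup 4 ⧸ U.toSubgroup) ∣ 8 := by
          have := Subgroup.card_quotient_dvd_card U.toSubgroup
          rwa [DihedralGroup.nat_card] at this
        have : p ∣ 2 ^ 3 := by simpa using hdvd.trans h8
        exact (Nat.prime_dvd_prime_iff_eq hp Nat.prime_two).mp (hp.dvd_of_dvd_pow this)⟩ }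
  have hsturdy : G.IsSturdy := fun _ => le_rfl
  have hG : Ω.IsOfPSCType G :=
    hΩ G (inferInstanceAs (IsEmpty Empty)) (inferInstanceAs (IsEmpty Empty)) (fun _ => rfl)
      ⟨(), fun _ => rfl⟩ hsturdy
  refine not_unrVerticialCharacterizationHolds_of_oneVertex Ω G hG () (fun _ => rfl) hsturdy ?_
  refine ⟨DihedralGroup.r 1, DihedralGroup.sr 0, fun h => ?_⟩
  simp [DihedralGroup.r_mul_sr, DihedralGroup.sr_mul_r] at h
  exact absurd h (by decide)

/-- **The universal closure of F-1938 is false** (plan R1 (ii)): take the all-inclusive origin.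
[cite: Mochizuki2012, IUTchI Rmk 1.2.3(iv) p.42] -/
theorem not_forall_unrVerticialCharacterizationHolds :
    ¬ ∀ Ω : PSCOrigin.{0}, UnrVerticialCharacterizationHolds Ω := fun h =>
  not_unrVerticialCharacterizationHolds_of_smoothProper_le ⟨fun _ => True⟩
    (fun _ _ _ _ _ _ _ _ _ _ => trivial) (h _)

/-- **Joint satisfiability of the [CombGC] §1 / Rmk. 1.2.3 fact family at the smooth-proper origin,
and failure of F-1938 there.**  The origin `Ω_sp` := "one vertex, no nodes, no cusps, `Π_v = Π`" is
INHABITED by the genuine sturdy datum of a smooth proper genus-2 curve in characteristic 0 (carrier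
`Ŝ₂` = profinite completion of the surface group `Γ_{2,0}`, `Σ` = all primes, genus 2), satisfies the
ten rows F-0438 (Prop. 1.2 (ii)), F-0459 (Prop. 1.2 (i)), F-0440 (Prop. 1.5 (i)), F-0443 (Prop. 1.5
(ii)), F-0458 (Thm. 1.6 (i)), F-0444 (Thm. 1.6 (ii)), F-0461 (Thm. 1.6 (iii)), F-0466 (Rmk. 1.4.3),
F-1931 (Rmk. 1.2.3 (iv) cuspidal), F-1937 (Rmk. 1.2.3 (v)), and VIOLATES F-1938 (Rmk. 1.2.3 (iv)
verticial, as typed).  Consistency evidence for the typed family, not the printed theorems.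
[cite: MochizukiCombGC2007, §1 pp.8-14] -/
theorem exists_smoothProperOrigin_holds :
    ∃ Ω : PSCOrigin.{0},
      (∃ G : PSCDatum (profiniteCompletion (PuncturedSurfaceGroup 2 0)),
        Ω.IsOfPSCType G ∧ G.IsSturdy ∧ G.Sigma = {p | p.Prime} ∧ G.graph.i = 1 ∧ G.graph.n = 0 ∧
          G.graph.r = 0 ∧ ∀ v, G.vertGp v = ⊤ ∧ G.genus v = 2) ∧
      CommensurableTerminalityHolds Ω ∧ OpenInterDeterminesComponentHolds Ω ∧
      EdgeLikeIncidenceHolds Ω ∧ GraphicIffEdgeLikeVerticialHolds Ω ∧ NumericallyCuspidalIffHolds Ω ∧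
      GraphicIffFiltrationPreservingHolds Ω ∧ UnrVerticialIffHolds Ω ∧ AuxiliaryCoveringsExistHolds Ω ∧
      CuspidalEdgeLikeCharacterizationHolds Ω ∧ NodalEdgeLikeCharacterizationHolds Ω ∧
      ¬ UnrVerticialCharacterizationHolds Ω := by
  let Ω : PSCOrigin.{0} :=
    ⟨fun G => IsEmpty G.graph.N ∧ IsEmpty G.graph.C ∧ (∀ v, G.vertGp v = ⊤) ∧
      ∃ v₀ : G.graph.V, ∀ w, w = v₀⟩
  have hΩ : ∀ ⦃Q : Type⦄ [Group Q] [TopologicalSpace Q] (G : PSCDatum Q), Ω.IsOfPSCType G →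
      IsEmpty G.graph.N ∧ IsEmpty G.graph.C ∧ (∀ v, G.vertGp v = ⊤) ∧ ∃ v₀ : G.graph.V, ∀ w, w = v₀ :=
    fun _ _ _ _ h => h
  let G : PSCDatum (profiniteCompletion (PuncturedSurfaceGroup 2 0)) :=
    { Sigma := {p | p.Prime}
      sigma_prime := fun _ hp => hp
      sigma_nonempty := ⟨2, Nat.prime_two⟩
      graph := { V := Unit, N := Empty, C := Empty, nodeEnds := Empty.elim, cuspEnd := Empty.elim }
      vertGp := fun _ => ⊤
      nodeGp := Empty.elim
      cuspGp := Empty.elim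
      genus := fun _ => 2
      isClosed_vertGp := fun _ => by rw [Subgroup.coe_top]; exact isClosed_univ
      isClosed_nodeGp := fun e => e.elim
      isClosed_cuspGp := fun c => c.elim
      nodeGp_le := fun e => e.elim
      cuspGp_le := fun c => c.elim
      proSigma := ⟨fun _ _ _ hp _ => hp⟩ }
  refine ⟨Ω, ⟨G, ⟨inferInstanceAs (IsEmpty Empty), inferInstanceAs (IsEmpty Empty), fun _ => rfl,
      (), fun _ => rfl⟩, fun _ => le_rfl, rfl, rfl, rfl, rfl, fun _ => ⟨rfl, rfl⟩⟩,
    commensurableTerminalityHolds_of_smoothProper Ω hΩ,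
    openInterDeterminesComponentHolds_of_smoothProper Ω hΩ, edgeLikeIncidenceHolds_of_smoothProper Ω hΩ,
    graphicIffEdgeLikeVerticialHolds_of_smoothProper Ω hΩ,
    numericallyCuspidalIffHolds_of_smoothProper Ω hΩ,
    graphicIffFiltrationPreservingHolds_of_smoothProper Ω hΩ, unrVerticialIffHolds_of_smoothProper Ω hΩ,
    auxiliaryCoveringsExistHolds_of_smoothProper Ω hΩ,
    cuspidalEdgeLikeCharacterizationHolds_of_smoothProper Ω hΩ,
    nodalEdgeLikeCharacterizationHolds_of_smoothProper Ω hΩ,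
    not_unrVerticialCharacterizationHolds_of_smoothProper_le Ω fun Q _ _ _ G hN hC hV hv _ =>
      ⟨hN, hC, hV, hv⟩⟩

end PSCDatum

end Literature.AnabelianGeometry.SemiGraphs

end
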